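import Summits.ValiantsHypothesis.ValiantsHypothesis.Theorems.DivisionGapSquareGridDimersDivisionEasySquare

/-!
# The square grid inside the Aztec diamond: the weights and the bridge

Weights `ew0 x` on the Aztec diamond of order `2k+1`: `x u v * x v u` on grid edges, `1` on edges
between two non-grid (corner) vertices, `0` on edges crossing the grid boundary (Propp 2003, §1.2 uses
`0` also inside the corners; weight `1` there keeps all cell factors nonzero and only multiplies the
partition function by the number of perfect matchings of the corner regions).  Main result:
`Z_univ_ew0 : Z univ (ew0 x) = sqSum x * #(perfect matchings of the corners)`, where `sqSum x` is the
item's involution sum. [cite: Propp2003, §1.2]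

All `def … : Prop` declarations in this file are decidable predicates on finite data (not named facts).
Support file for `SquareGridDimersDivisionEasy` (route DivisionGap, item stmt-ValiantsHypothesis-5072);
the closing theorem is `squareGridDimersDivisionEasy_proof` in `…DivisionGapSquareGridDimersDivisionEasy.lean`.
-/

namespace Summit.ValiantsHypothesis.ValiantsHypothesis.Theorems

namespace SquareGridDimers

set_option linter.dupNamespace false

noncomputable section

open Finset

/-! ## Grid edges and the bridge for the square grid -/

section GridEdges

variable {kk : ℕ}

/-- Grid edges: edges of the Aztec diamond with both endpoints in the grid. [cite: Propp2003, §1.2] -/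
def IsGridEdge (e : E (2 * kk + 1)) : Prop := InRange kk (gH kk e) ∧ InRange kk (gV kk e)

/-- Being a grid edge is decidable. [folklore] -/
instance (e : E (2 * kk + 1)) : Decidable (IsGridEdge (kk := kk) e) := by
  unfold IsGridEdge; infer_instance

variable (kk) in
/-- The type of grid edges. [folklore] -/
abbrev GEdge : Type := {e : E (2 * kk + 1) // IsGridEdge (kk := kk) e}

/-- The even endpoint of a grid edge. [folklore] -/
def ga (e : GEdge kk) : GV kk := toGV kk (gH kk e.val)

/-- The odd endpoint of a grid edge. [folklore] -/
def gb (e : GEdge kk) : GV kk := toGV kk (gV kk e.val)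

variable (kk) in
/-- The grid's vertices inside the Aztec diamond. [cite: Propp2003, §1.2] -/
def G : Finset (V (2 * kk + 1)) := univ.image (ψ kk)

/-- The item's involution sum with general pair weights `x`: for `x u v = X_(u,v)` this is the
domino polynomial `D_{2k+2}` of the item (doubled edge variables). [folklore] -/
def sqSum {R : Type*} [CommSemiring R] (x : GV kk → GV kk → R) : R :=
  ∑ f ∈ (univ : Finset (GV kk → GV kk)).filter (fun f => ∀ v, f (f v) = v ∧ f v ≠ v ∧ Adj4 v (f v)),
    ∏ v : GV kk, x v (f v)

/-- The weights of the Aztec diamond realizing the square grid: `x u v * x v u` on grid edges, `1` on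
edges between two non-grid vertices, `0` on the edges crossing the grid boundary (Propp 2003, §1.2,
with weight `1` instead of `0` on the unused corner-internal edges so that no cell factor vanishes).
[cite: Propp2003, §1.2] -/
def ew0 {R : Type*} [CommSemiring R] (x : GV kk → GV kk → R) (e : E (2 * kk + 1)) : R :=
  if InRange kk (gH kk e) ∧ InRange kk (gV kk e) then
    x (toGV kk (gH kk e)) (toGV kk (gV kk e)) * x (toGV kk (gV kk e)) (toGV kk (gH kk e))
  else if ¬ InRange kk (gH kk e) ∧ ¬ InRange kk (gV kk e) then 1 else 0

/-- Even and odd endpoints differ. [folklore] -/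
theorem ga_ne_gb (e e' : GEdge kk) : ga e ≠ gb e' := toGV_gH_ne_toGV_gV e.val e'.val e.prop.1 e'.prop.2

/-- A grid edge is determined by its endpoints. [folklore] -/
theorem gEdge_eq (e e' : GEdge kk) (h1 : ga e = ga e') (h2 : gb e = gb e') : e = e' := by
  apply Subtype.ext
  apply edge_eq_of_ends
  · rw [← ψ_toGV_gH e.val e.prop.1, ← ψ_toGV_gH e'.val e'.prop.1]
    exact congrArg (ψ kk) h1
  · rw [← ψ_toGV_gV e.val e.prop.2, ← ψ_toGV_gV e'.val e'.prop.2]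
    exact congrArg (ψ kk) h2

/-- Abstract adjacency of the grid-edge graph is the item's adjacency. [folklore] -/
theorem adjE_iff_adj4 (u v : GV kk) : AdjE (ga (kk := kk)) gb u v ↔ Adj4 u v := by
  constructor
  · rintro ⟨e, ⟨h1, h2⟩ | ⟨h1, h2⟩⟩
    · rw [← h1, ← h2]; exact adj4_of_edge e.val e.prop.1 e.prop.2
    · rw [← h1, ← h2]; exact adj4_symm _ _ (adj4_of_edge e.val e.prop.1 e.prop.2)
  · intro h
    obtain ⟨e, h1, h2, h3⟩ := exists_edge_of_adj4 u v h
    exact ⟨⟨e, h1, h2⟩, h3⟩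

/-- A horizontal endpoint is a grid vertex iff its grid coordinates are in range. [folklore] -/
theorem hEnd_mem_G_iff (e : E (2 * kk + 1)) : hEnd e ∈ G kk ↔ InRange kk (gH kk e) := by
  unfold G
  rw [mem_image]
  constructor
  · rintro ⟨v, -, hv⟩; exact (inRange_gH_of_eq e v hv).1
  · intro h; exact ⟨_, mem_univ _, ψ_toGV_gH e h⟩

/-- A vertical endpoint is a grid vertex iff its grid coordinates are in range. [folklore] -/
theorem vEnd_mem_G_iff (e : E (2 * kk + 1)) : vEnd e ∈ G kk ↔ InRange kk (gV kk e) := by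
  unfold G
  rw [mem_image]
  constructor
  · rintro ⟨v, -, hv⟩; exact (inRange_gV_of_eq e v hv).1
  · intro h; exact ⟨_, mem_univ _, ψ_toGV_gV e h⟩

/-- Incidence of a grid edge with an embedded grid vertex. [folklore] -/
theorem inc_ψ_iff (e : GEdge kk) (v : GV kk) : Inc e.val (ψ kk v) ↔ ga e = v ∨ gb e = v := by
  unfold Inc
  rw [← ψ_toGV_gH e.val e.prop.1, ← ψ_toGV_gV e.val e.prop.2, ψ_injective.eq_iff, ψ_injective.eq_iff]
  rfl

/-- Degrees of an embedded grid-edge set at grid vertices. [folklore] -/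
theorem deg_map_ψ (M : Finset (GEdge kk)) (v : GV kk) :
    deg (M.map (Function.Embedding.subtype _)) (ψ kk v) = (edgesAt ga gb M v).card := by
  classical
  unfold deg edgesAt
  rw [filter_map, card_map]
  congr 1
  exact filter_congr fun e _ => by simpa using inc_ψ_iff e v

/-- Degrees of an embedded grid-edge set vanish off the grid. [folklore] -/
theorem deg_map_of_not_mem_G (M : Finset (GEdge kk)) (u : V (2 * kk + 1)) (hu : u ∉ G kk) :
    deg (M.map (Function.Embedding.subtype _)) u = 0 := by
  classical
  unfold deg
  rw [card_eq_zero, filter_eq_empty_iff]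
  intro e he hinc
  rw [mem_map] at he
  obtain ⟨e', _, rfl⟩ := he
  rcases hinc with h | h
  · exact hu (h ▸ (hEnd_mem_G_iff e'.val).mpr e'.prop.1)
  · exact hu (h ▸ (vEnd_mem_G_iff e'.val).mpr e'.prop.2)

/-- Embedded perfect matchings of the grid-edge graph are the perfect matchings of the grid vertices.
[folklore] -/
theorem isPM_map_iff_mem_pmE (M : Finset (GEdge kk)) :
    IsPM (G kk) (M.map (Function.Embedding.subtype _)) ↔ M ∈ pmE ga gb := by
  rw [mem_pmE]
  constructor
  · intro h v
    have := h (ψ kk v)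
    rw [deg_map_ψ, if_pos (by unfold G; exact mem_image_of_mem _ (mem_univ v))] at this
    exact this
  · intro h u
    by_cases hu : u ∈ G kk
    · rw [if_pos hu]
      obtain ⟨v, -, rfl⟩ := mem_image.mp hu
      rw [deg_map_ψ, h v]
    · rw [if_neg hu, deg_map_of_not_mem_G M u hu]

/-- The edges of a perfect matching of the grid vertices are grid edges. [folklore] -/
theorem isGridEdge_of_mem {M : Finset (E (2 * kk + 1))} (hM : IsPM (G kk) M) {e : E (2 * kk + 1)}
    (he : e ∈ M) : IsGridEdge (kk := kk) e := by
  obtain ⟨h1, h2⟩ := mem_of_isPM hM he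
  exact ⟨(hEnd_mem_G_iff e).mp h1, (vEnd_mem_G_iff e).mp h2⟩

/-- The partition function of the grid vertices as a sum over abstract perfect matchings of the
grid-edge graph. [folklore] -/
theorem Z_G_eq_sum_pmE {R : Type*} [CommSemiring R] (ew : E (2 * kk + 1) → R) :
    Z (G kk) ew = ∑ M ∈ pmE (ga (kk := kk)) gb, ∏ e ∈ M, ew e.val := by
  classical
  unfold Z
  symm
  refine sum_bij' (fun M _ => M.map (Function.Embedding.subtype _))
    (fun M _ => M.subtype (IsGridEdge (kk := kk))) ?_ ?_ ?_ ?_ ?_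
  · intro M hM; rw [mem_pmSet]; exact (isPM_map_iff_mem_pmE M).mpr hM
  · intro M hM
    rw [mem_pmSet] at hM
    rw [← isPM_map_iff_mem_pmE, subtype_map_of_mem fun e he => isGridEdge_of_mem hM he]
    exact hM
  · intro M _
    ext e
    simp only [mem_subtype, mem_map, Function.Embedding.coe_subtype]
    constructor
    · rintro ⟨e', he', h⟩; rwa [← Subtype.ext h]
    · intro he; exact ⟨e, he, rfl⟩
  · intro M hM
    rw [mem_pmSet] at hM
    rw [subtype_map_of_mem fun e he => isGridEdge_of_mem hM he]
  · intro M _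
    rw [prod_map]
    rfl

/-- **The bridge for the square grid.** The item's involution sum is the dimer partition function of
the grid vertices of the weighted Aztec diamond. [cite: Propp2003, §1.2] -/
theorem sqSum_eq_Z_G {R : Type*} [CommSemiring R] (x : GV kk → GV kk → R) :
    sqSum x = Z (G kk) (ew0 x) := by
  classical
  have h1 : sqSum x = ∑ f ∈ invols (ga (kk := kk)) gb, ∏ v, x v (f v) := by
    unfold sqSum invols
    congr 1
    refine filter_congr fun f _ => ?_
    simp only [adjE_iff_adj4]
  rw [h1, sum_invols_eq_sum_pmE ga_ne_gb gEdge_eq x, Z_G_eq_sum_pmE]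
  refine sum_congr rfl fun M _ => prod_congr rfl fun e _ => ?_
  unfold ew0
  rw [if_pos (show InRange kk (gH kk e.val) ∧ InRange kk (gV kk e.val) from e.prop)]
  rfl

/-- Off the grid all weights met by a perfect matching are `1`. [folklore] -/
theorem Z_G_compl {R : Type*} [CommSemiring R] (x : GV kk → GV kk → R) :
    Z (G kk)ᶜ (ew0 x) = ((pmSet (G kk)ᶜ).card : R) := by
  unfold Z
  rw [sum_congr rfl fun M hM => prod_eq_one fun e he => ?_]
  · simp
  · rw [mem_pmSet] at hM
    obtain ⟨h1, h2⟩ := mem_of_isPM hM he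
    rw [mem_compl, hEnd_mem_G_iff] at h1
    rw [mem_compl, vEnd_mem_G_iff] at h2
    unfold ew0
    rw [if_neg (fun h => h1 h.1), if_pos ⟨h1, h2⟩]

/-- Crossing edges have weight zero. [folklore] -/
theorem ew0_eq_zero_of_crosses {R : Type*} [CommSemiring R] (x : GV kk → GV kk → R) (e : E (2 * kk + 1))
    (h : Crosses (G kk) e) : ew0 x e = 0 := by
  unfold Crosses at h
  rw [hEnd_mem_G_iff, vEnd_mem_G_iff] at h
  unfold ew0
  rw [if_neg (fun hh => h.mp hh.1 hh.2), if_neg (fun hh => hh.1 (h.mpr hh.2))]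

/-- **The square grid inside the Aztec diamond.** The dimer partition function of the weighted Aztec
diamond of order `2k+1` is the item's involution sum for the `(2k+2) × (2k+2)` grid times the
(natural) number of perfect matchings of the four corner regions. [cite: Propp2003, §1.2] -/
theorem Z_univ_ew0 {R : Type*} [CommSemiring R] (x : GV kk → GV kk → R) :
    Z univ (ew0 x) = sqSum x * ((pmSet (G kk)ᶜ).card : R) := by
  rw [Z_univ_eq_Z_mul_Z_compl (G kk) (ew0 x) (ew0_eq_zero_of_crosses x), sqSum_eq_Z_G, Z_G_compl]

end GridEdges

end

end SquareGridDimers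

end Summit.ValiantsHypothesis.ValiantsHypothesis.Theorems
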